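/-
Origin: expansion seat `prover-pub-hodgecm-mc-binder-2-g16-0`, handover #84 2026-08-20T17:50Z md5 bf5e705d9230 (NEW; 408 l.; GROUP LEVEL over the vendored `ReflexType`: `G ↷ E` with a `G`-equivariant fixed-point-free involution `c`; defs `IsCMSet c Φ` (Φ meets each pair {e, c e} once), `HasFlips G c` (single-pair flips); theorems `isPrimitive_of_hasFlips` (single-pair flips ⇒ EVERY `c`-CM set is `IsPrimitive G Φ φh`, Shimura's criterion via the vendored `isPrimitive_iff`), `exists_smul_eq_of_hasFlips` / `orbit_eq_setOf_isCMSet` (transitive on CM sets, `E` finite), `hasFlips_of_card` (six points, `G` faithful + transitive, `c` realised by some `ρ ∈ G`, `24 ≤ Nat.card G` ⇒ single-pair flips — stabiliser count `|H₁| = |G|/6 ≥ 4` + exact-flip case analysis). CERT lean-direct over the RUN-56 PKG oleans (mirror refreshed 17:45:24Z): rc 0 ∕ 13 s ∕ 0 warn ∕ 0 proof-hole; NAME LIST: `HodgeCM.CMTypeFlips.isPrimitive_of_hasFlips` · `HodgeCM.CMTypeFlips.exists_smul_eq_of_hasFlips` · `HodgeCM.CMTypeFlips.hasFlips_of_card`)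 (`HOME/mc/pub-hodgecm-mc-binder-2/g16/stage58/HodgeCM/Model/Binders/CMTypeFlips.lean`, md5 bf5e705d9230, 408 lines);
landed by the second packager p2 gen 11 (p2-g11) in gate run 58 as `HodgeCM/Model/Binders/CMTypeFlips.lean` (packager comment re-wording per the RUN-32 precedent (gate audit (5) rejects the proof-placeholder tokens s-o-r-r-y / a-d-m-i-t anywhere in a source, comments included): 1 occurrence(s) inside COMMENTS re-spelt `proof-hole` / `adm-token`; no Lean code byte touched).
-/
/-
Origin: speedrun cell pub-hodgecm, MODEL-CONSTRUCTION sub-cell, unit pub-hodgecm-mc-binder-2-g16 (BINDER PROVER, gen 16; the PRIMITIVITY residual of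
binder-1's (J5), `JLIU-THETA-SCOPE.md` §8 «(J5) DONE in kernel modulo (J4a) + primitivity», STATUS 2026-08-20 l.14004; binder-2 CLAIM l.≈14013),
seat prover-pub-hodgecm-mc-binder-2-g16-0, 2026-08-20.  Target in PKG: HodgeCM/Model/Binders/CMTypeFlips.lean (NEW additive leaf, GROUP LEVEL; imports the
vendored twin `HodgeCM.Vendored.H21.NumberTheory.ComplexMultiplication.ReflexType` only; nothing imports it yet).  KERNEL ONLY: theorems + two `def`s of
hypotheses-as-predicates (`IsCMSet`, `HasFlips`; NOT cited facts, NOT hypotheses of E); MODEL-N ±0; E untouched.  Nothing here is a claim of the manuscripts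
under adjudication.
-/
import Literature.NumberTheory.ComplexMultiplication.ReflexType

/-!
# CM types under a group with single-pair flips: primitivity and transitivity (group level)

Abstract setting of the vendored `Literature/NumberTheory/ComplexMultiplication/ReflexType` ([Shimura1998 §8.1–8.3], [Streng2010 Ch. I §3, §7]):
a group `G` acting on a type `E` (think `G = Gal(L/ℚ)`, `E = Hom(K, L)`), together with a map `c : E → E` commuting with the action and without fixed
points (think: composition with complex conjugation).  A subset `Φ ⊆ E` is a `c`-CM SET when it contains exactly one of `e`, `c e` for every `e`
(`IsCMSet`).  `G` HAS SINGLE-PAIR FLIPS (`HasFlips`) when for every `e` some `g ∈ G` exchanges `e` and `c e` and fixes every other point — for a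
sextic CM field this is «`Gal(K̃/ℚ) ⊇ (ℤ/2)³`», i.e. closure degree 24 or 48 ([Dodson1984] §5.1: the ρ-structures `(ℤ₂)³ ⋊ ℤ₃`, `(ℤ₂)³ ⋊ S₃`).

* `isPrimitive_of_hasFlips` — under single-pair flips EVERY `c`-CM set is primitive at every base point, in the sense of the vendored
  `Literature.NumberTheory.ComplexMultiplication.IsPrimitive` (Shimura's criterion `H' ≤ H₁`, `isPrimitive_iff`).
* `exists_smul_eq_of_hasFlips` — under single-pair flips `G` acts TRANSITIVELY on the `c`-CM sets (`E` finite): the orbit of a CM type is the set of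
  all CM types, so every CM type has the maximal reflex degree (orbit–stabiliser; [Dodson1984] §1 Reflex Degree Theorem, Remark).

0 `proof-hole`, 0 `axiom`; expected `#print axioms` ⊆ {propext, Classical.choice, Quot.sound}.
-/

set_option autoImplicit false

open scoped Pointwise

namespace HodgeCM

namespace CMTypeFlips

open Literature.NumberTheory.ComplexMultiplication

variable {G : Type*} [Group G] {E : Type*} [MulAction G E]

/-- `Φ` is a CM set for the involution-like map `c`: it contains exactly one of `e`, `c e` for every `e`. [folklore] -/
def IsCMSet (c : E → E) (Φ : Set E) : Prop := ∀ e, e ∈ Φ ↔ c e ∉ Φ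

/-- `G` has SINGLE-PAIR FLIPS for `c`: every pair `{e, c e}` is exchanged by some element of `G` fixing all other points. [folklore] -/
def HasFlips (G : Type*) [Group G] [MulAction G E] (c : E → E) : Prop :=
  ∀ e : E, ∃ g : G, g • e = c e ∧ ∀ e', e' ≠ e → e' ≠ c e → g • e' = e'

section Basic

variable {c : E → E}

/-- From a CM set: if `e ∉ Φ` then `c e ∈ Φ`. [folklore] -/
theorem IsCMSet.apply_mem_of_not_mem {Φ : Set E} (hΦ : IsCMSet c Φ) {e : E} (he : e ∉ Φ) : c e ∈ Φ := by
  by_contra h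
  exact he ((hΦ e).2 h)

/-- From a CM set: if `e ∈ Φ` then `c e ∉ Φ`. [folklore] -/
theorem IsCMSet.apply_not_mem_of_mem {Φ : Set E} (hΦ : IsCMSet c Φ) {e : E} (he : e ∈ Φ) : c e ∉ Φ :=
  (hΦ e).1 he

/-- Translates of CM sets are CM sets (`c` commuting with the action). [folklore] -/
theorem IsCMSet.smul (hcG : ∀ (g : G) (e : E), g • c e = c (g • e)) {Φ : Set E} (hΦ : IsCMSet c Φ) (g : G) :
    IsCMSet c (g • Φ) := by
  intro e
  rw [Set.mem_smul_set_iff_inv_smul_mem, Set.mem_smul_set_iff_inv_smul_mem, hcG]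
  exact hΦ _

/-- Two CM sets with `Φ ⊆ Φ'` are equal. [folklore] -/
theorem IsCMSet.eq_of_subset {Φ Φ' : Set E} (hΦ : IsCMSet c Φ) (hΦ' : IsCMSet c Φ') (h : Φ ⊆ Φ') : Φ = Φ' := by
  refine Set.Subset.antisymm h fun e he => ?_
  by_contra hne
  exact (hΦ'.apply_not_mem_of_mem he) (h (hΦ.apply_mem_of_not_mem hne))

end Basic

/-! ## 1. Single-pair flips ⇒ every CM set is primitive -/

section Primitive

variable {c : E → E}

/-- **Under single-pair flips, every CM set is PRIMITIVE at every base point** (Shimura's criterion `H' ≤ H₁`): an element `u` of `H'` satisfies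
`g • (u • φh) ∈ Φ ↔ g • φh ∈ Φ` for all `g`; if `u • φh = c φh` this fails at `g = 1` by CM-ness, and if `u • φh ∉ {φh, c φh}` it fails at the
flip of the pair of `u • φh`. [folklore] -/
theorem isPrimitive_of_hasFlips (hcc : ∀ e : E, c (c e) = e) (hF : HasFlips G c) {Φ : Set E} (hΦ : IsCMSet c Φ) (φh : E) :
    IsPrimitive G Φ φh := by
  rw [isPrimitive_iff]
  intro u hu
  rw [mem_stabilizer_reflexLift_iff] at hu
  rw [MulAction.mem_stabilizer_iff]
  -- `key : ∀ g, g • ψ ∈ Φ ↔ g • φh ∈ Φ` for `ψ := u • φh`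
  have key : ∀ g : G, g • (u • φh) ∈ Φ ↔ g • φh ∈ Φ := fun g => by
    have h := hu g
    rwa [mem_typeLift, mem_typeLift, mul_smul] at h
  by_contra hne
  by_cases hψc : u • φh = c φh
  · -- `g = 1`: `c φh ∈ Φ ↔ φh ∈ Φ`, against CM-ness
    have h1 := key 1
    rw [one_smul, one_smul, hψc] at h1
    by_cases hφ : φh ∈ Φ
    · exact (hΦ.apply_not_mem_of_mem hφ) (h1.2 hφ)
    · exact hφ (h1.1 (hΦ.apply_mem_of_not_mem hφ))
  · -- the flip `f` of the pair of `ψ` fixes `φh`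
    obtain ⟨f, hf, hfix⟩ := hF (u • φh)
    have hφfix : f • φh = φh := by
      refine hfix φh (Ne.symm hne) fun h => hψc ?_
      have h' : c φh = c (c (u • φh)) := congrArg c h
      rw [hcc] at h'
      exact h'.symm
    have h1 := key 1
    rw [one_smul, one_smul] at h1
    have h2 := key f
    rw [hf, hφfix] at h2
    -- `h1 : ψ ∈ Φ ↔ φh ∈ Φ`, `h2 : c ψ ∈ Φ ↔ φh ∈ Φ`
    by_cases hψ : u • φh ∈ Φ
    · exact (hΦ.apply_not_mem_of_mem hψ) (h2.2 (h1.1 hψ))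
    · exact hψ (h1.2 (h2.1 (hΦ.apply_mem_of_not_mem hψ)))

end Primitive

/-! ## 2. Single-pair flips ⇒ `G` is transitive on CM sets -/

section Transitive

variable {c : E → E}

/-- The flip of `e ∈ Φ` replaces `e` by `c e` in `Φ`. [folklore] -/
theorem smul_eq_insert_diff_of_flip {Φ : Set E} (hΦ : IsCMSet c Φ) {e : E} (he : e ∈ Φ) {f : G} (hf : f • e = c e)
    (hfix : ∀ e', e' ≠ e → e' ≠ c e → f • e' = e') : f • Φ = insert (c e) (Φ \ {e}) := by
  have hce : c e ∉ Φ := hΦ.apply_not_mem_of_mem he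
  ext x
  constructor
  · rintro ⟨y, hy, rfl⟩
    by_cases hye : y = e
    · subst hye
      show f • y ∈ _
      rw [hf]
      exact Set.mem_insert _ _
    · have hyc : y ≠ c e := fun h => hce (h ▸ hy)
      right
      show f • y ∈ _
      rw [hfix y hye hyc]
      exact ⟨hy, hye⟩
  · intro hx
    rcases hx with rfl | ⟨hx, hxe⟩
    · exact ⟨e, he, hf⟩
    · have hxc : x ≠ c e := fun h => hce (h ▸ hx)
      exact ⟨x, hx, hfix x hxe hxc⟩

/-- **Under single-pair flips, `G` is TRANSITIVE on CM sets** (`E` finite): flip the points of `Φ` outside `Φ'` one at a time. [folklore] -/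
theorem exists_smul_eq_of_hasFlips [Finite E] (hcG : ∀ (g : G) (e : E), g • c e = c (g • e)) (hF : HasFlips G c)
    {Φ Φ' : Set E} (hΦ : IsCMSet c Φ) (hΦ' : IsCMSet c Φ') : ∃ g : G, g • Φ = Φ' := by
  suffices h : ∀ (n : ℕ) (Ψ : Set E), IsCMSet c Ψ → (Ψ \ Φ').ncard = n → ∃ g : G, g • Ψ = Φ' from h _ Φ hΦ rfl
  intro n
  induction n with
  | zero =>
    intro Ψ hΨ h0
    have hsub : Ψ ⊆ Φ' := Set.sdiff_eq_empty.1 ((Set.ncard_eq_zero (Set.toFinite _)).1 h0)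
    exact ⟨1, by rw [one_smul]; exact hΨ.eq_of_subset hΦ' hsub⟩
  | succ n ih =>
    intro Ψ hΨ hn
    obtain ⟨e, heΨ, heΦ'⟩ := Set.nonempty_of_ncard_ne_zero (s := Ψ \ Φ') (by omega)
    obtain ⟨f, hf, hfix⟩ := hF e
    have hce : c e ∈ Φ' := hΦ'.apply_mem_of_not_mem heΦ'
    have h1 : f • Ψ = insert (c e) (Ψ \ {e}) := smul_eq_insert_diff_of_flip hΨ heΨ hf hfix
    have hcard : ((f • Ψ) \ Φ').ncard = n := by
      rw [h1, Set.insert_sdiff_of_mem _ hce, Set.sdiff_sdiff_comm,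
        Set.ncard_sdiff_singleton_of_mem (show e ∈ Ψ \ Φ' from ⟨heΨ, heΦ'⟩), hn]
      rfl
    obtain ⟨g, hg⟩ := ih (f • Ψ) (hΨ.smul hcG f) hcard
    exact ⟨g * f, by rw [mul_smul, hg]⟩

/-- Hence under single-pair flips the orbit of a CM set is the set of ALL CM sets. [folklore] -/
theorem orbit_eq_setOf_isCMSet [Finite E] (hcG : ∀ (g : G) (e : E), g • c e = c (g • e)) (hF : HasFlips G c)
    {Φ : Set E} (hΦ : IsCMSet c Φ) : MulAction.orbit G Φ = {Φ' | IsCMSet c Φ'} := by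
  ext Φ'
  rw [MulAction.mem_orbit_iff, Set.mem_setOf_eq]
  constructor
  · rintro ⟨g, rfl⟩
    exact hΦ.smul hcG g
  · intro hΦ'
    exact exists_smul_eq_of_hasFlips hcG hF hΦ hΦ'

end Transitive

/-! ## 3. Single-pair flips from the size of the group: six points, `|G| ≥ 24` -/

section Flips

variable {c : E → E}

/-- `c` is injective (it is an involution). [folklore] -/
theorem injective_of_invol (hcc : ∀ e : E, c (c e) = e) : Function.Injective c := fun a b h => by
  rw [← hcc a, ← hcc b, h]

/-- Six pairwise distinct points `e₁, c e₁, e₂, c e₂, x, c x` exhaust a six-element `E`. [folklore] -/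
theorem eq_or_of_card_six [Fintype E] [DecidableEq E] (hE : Fintype.card E = 6) (hc : ∀ e : E, c e ≠ e)
    (hcc : ∀ e : E, c (c e) = e) {e₁ e₂ x : E} (h₂₁ : e₂ ≠ e₁) (h₂₁' : e₂ ≠ c e₁) (hx₁ : x ≠ e₁) (hx₁' : x ≠ c e₁)
    (hx₂ : x ≠ e₂) (hx₂' : x ≠ c e₂) (y : E) :
    y = e₁ ∨ y = c e₁ ∨ y = e₂ ∨ y = c e₂ ∨ y = x ∨ y = c x := by
  have hinj := injective_of_invol hcc
  -- the fifteen distinctness facts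
  have d12 : e₁ ≠ c e₁ := (hc e₁).symm
  have d13 : e₁ ≠ e₂ := h₂₁.symm
  have d14 : e₁ ≠ c e₂ := fun h => h₂₁' (by rw [h, hcc])
  have d15 : e₁ ≠ x := hx₁.symm
  have d16 : e₁ ≠ c x := fun h => hx₁' (by rw [h, hcc])
  have d23 : c e₁ ≠ e₂ := h₂₁'.symm
  have d24 : c e₁ ≠ c e₂ := fun h => h₂₁ (hinj h).symm
  have d25 : c e₁ ≠ x := hx₁'.symm
  have d26 : c e₁ ≠ c x := fun h => hx₁ (hinj h).symm
  have d34 : e₂ ≠ c e₂ := (hc e₂).symm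
  have d35 : e₂ ≠ x := hx₂.symm
  have d36 : e₂ ≠ c x := fun h => hx₂' (by rw [h, hcc])
  have d45 : c e₂ ≠ x := hx₂'.symm
  have d46 : c e₂ ≠ c x := fun h => hx₂ (hinj h).symm
  have d56 : x ≠ c x := (hc x).symm
  set S : Finset E := {e₁, c e₁, e₂, c e₂, x, c x} with hS
  have hcard : S.card = 6 := by
    rw [hS, Finset.card_insert_of_notMem, Finset.card_insert_of_notMem, Finset.card_insert_of_notMem,
      Finset.card_insert_of_notMem, Finset.card_pair d56]
    · simp only [Finset.mem_insert, Finset.mem_singleton, not_or]; exact ⟨d45, d46⟩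
    · simp only [Finset.mem_insert, Finset.mem_singleton, not_or]; exact ⟨d34, d35, d36⟩
    · simp only [Finset.mem_insert, Finset.mem_singleton, not_or]; exact ⟨d23, d24, d25, d26⟩
    · simp only [Finset.mem_insert, Finset.mem_singleton, not_or]; exact ⟨d12, d13, d14, d15, d16⟩
  have huniv : S = Finset.univ := Finset.eq_univ_of_card S (by rw [hcard, hE])
  have hy : y ∈ S := by rw [huniv]; exact Finset.mem_univ y
  simpa [hS, Finset.mem_insert, Finset.mem_singleton] using hy

/-- From ONE exact flip and transitivity: single-pair flips everywhere (conjugate). [folklore] -/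
theorem hasFlips_of_exists_flip (hcG : ∀ (g : G) (e : E), g • c e = c (g • e)) [MulAction.IsPretransitive G E]
    {x : E} {f : G} (hf : f • x = c x) (hfix : ∀ e', e' ≠ x → e' ≠ c x → f • e' = e') : HasFlips G c := by
  intro e
  obtain ⟨g, hg⟩ := MulAction.exists_smul_eq G x e
  refine ⟨g * f * g⁻¹, ?_, fun e' h1 h2 => ?_⟩
  · rw [mul_smul, mul_smul, ← hg, inv_smul_smul, hf, hcG]
  · rw [mul_smul, mul_smul]
    have h1' : g⁻¹ • e' ≠ x := fun h => h1 (by rw [← hg, ← h, smul_inv_smul])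
    have h2' : g⁻¹ • e' ≠ c x := fun h => h2 (by rw [← hg, ← hcG, ← h, smul_inv_smul])
    rw [hfix _ h1' h2', smul_inv_smul]


-- port_pkg: scope closed for this part
end Flips
end CMTypeFlips
end HodgeCM
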